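import Mathlib.Analysis.Fourier.LpSpace
import Mathlib.Analysis.InnerProductSpace.Continuous
import Literature.NumberTheory.ConnesConsani2021.ApproxNumberCalculus
import HarnessLib

/-!
# Fourier conjugation of bounded operators on `L²(ℝ)` is determined by Schwartz matrix coefficients

RH-FREE operator theory (cell `rh-crit`, sub-cell cc, seat t13; a brick of the planned discharge of the tree fact
`CC2021_lemma_D47`, Connes–Consani 2021 App. D Lemma D.1 (47): "`[H, f] = 𝔽_C[1_P, K]𝔽_C⁻¹`", p. 33 L24).
The frame used to move the infinite-order question for `[H, f]` to the frequency side: with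
`U = 𝓕 : L²(ℝ) ≃ₗᵢ L²(ℝ)` (Mathlib `MeasureTheory.Lp.fourierTransformₗᵢ`), two bounded operators `A`, `B` satisfy
`U A U⁻¹ = B` as soon as `⟪Aφ, ψ⟫ = ⟪B φ̂, ψ̂⟫` for all Schwartz `φ, ψ` (Schwartz functions are dense in `L²` and
`𝓕` is a bijection of `𝒮`); then `A` is of infinite order iff `B` is (`isInfiniteOrder_conj_iff`).
WHAT THIS IS NOT: any claim about RH.  Theorems only; no definition, no named fact (net debt 0).
-/

noncomputable section

open MeasureTheory SchwartzMap FourierTransform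

namespace Literature.NumberTheory.ConnesConsani2021

-- The unification of the `volume` instance hidden in `Lp.fourierTransformₗᵢ ℝ ℂ` with the one of
-- `Lp (α := ℝ) ℂ 2` is expensive (cf. the comment in Mathlib's `Analysis/Fourier/LpSpace`).
set_option maxHeartbeats 800000 in
/-- RH-FREE. **Fourier conjugates are determined by Schwartz matrix coefficients**: if
`⟪A φ, ψ⟫_{L²} = ⟪B φ̂, ψ̂⟫_{L²}` for all Schwartz `φ, ψ` (with `φ̂ = 𝓕φ` viewed in `L²`), then
`𝓕 ∘ A ∘ 𝓕⁻¹ = B` on `L²(ℝ)`.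
[cite: ConnesConsani2021, App. D Lemma 47 proof p. 33 (arXiv chunk p0033:L24: `[H,f] = 𝔽_C[1_P,K]𝔽_C⁻¹`)] -/
theorem fourierConj_eq_of_inner_schwartz (A B : Lp (α := ℝ) ℂ 2 →L[ℂ] Lp (α := ℝ) ℂ 2)
    (h : ∀ φ ψ : SchwartzMap ℝ ℂ,
      inner ℂ (A (φ.toLp 2 (volume : Measure ℝ))) (ψ.toLp 2 (volume : Measure ℝ)) =
        inner ℂ (B ((𝓕 φ).toLp 2 (volume : Measure ℝ))) ((𝓕 ψ).toLp 2 (volume : Measure ℝ))) :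
    ((Lp.fourierTransformₗᵢ ℝ ℂ : Lp (α := ℝ) ℂ 2 ≃ₗᵢ[ℂ] Lp (α := ℝ) ℂ 2) :
        Lp (α := ℝ) ℂ 2 →L[ℂ] Lp (α := ℝ) ℂ 2).comp
      (A.comp ((Lp.fourierTransformₗᵢ ℝ ℂ).symm : Lp (α := ℝ) ℂ 2 →L[ℂ] Lp (α := ℝ) ℂ 2)) = B := by
  generalize hU : Lp.fourierTransformₗᵢ ℝ ℂ = U
  -- the `L²` Fourier transform of a Schwartz representative
  have hFL : ∀ φ : SchwartzMap ℝ ℂ,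
      ((𝓕 φ).toLp 2 (volume : Measure ℝ) : Lp (α := ℝ) ℂ 2) = U (φ.toLp 2 (volume : Measure ℝ)) := by
    intro φ
    rw [← SchwartzMap.toLp_fourier_eq φ, ← hU]
    rfl
  -- the hypothesis in `U`-form
  have h' : ∀ φ ψ : SchwartzMap ℝ ℂ,
      inner ℂ (A (φ.toLp 2 (volume : Measure ℝ))) (ψ.toLp 2 (volume : Measure ℝ)) =
        inner ℂ (B (U (φ.toLp 2 (volume : Measure ℝ)))) (U (ψ.toLp 2 (volume : Measure ℝ))) := by
    intro φ ψ
    rw [← hFL, ← hFL]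
    exact h φ ψ
  -- how the conjugate acts
  have happly : ∀ x : Lp (α := ℝ) ℂ 2,
      (((U : Lp (α := ℝ) ℂ 2 ≃ₗᵢ[ℂ] Lp (α := ℝ) ℂ 2) : Lp (α := ℝ) ℂ 2 →L[ℂ] Lp (α := ℝ) ℂ 2).comp
          (A.comp (U.symm : Lp (α := ℝ) ℂ 2 →L[ℂ] Lp (α := ℝ) ℂ 2))) x = U (A (U.symm x)) := by
    intro x
    simp only [ContinuousLinearMap.coe_comp, Function.comp_apply, ContinuousLinearEquiv.coe_coe,
      LinearIsometryEquiv.coe_toContinuousLinearEquiv]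
  -- Step 1: matrix coefficients on Schwartz representatives
  have key : ∀ φ ψ : SchwartzMap ℝ ℂ,
      inner ℂ (U (A (U.symm (U (φ.toLp 2 (volume : Measure ℝ)))))) (U (ψ.toLp 2 (volume : Measure ℝ))) =
        inner ℂ (B (U (φ.toLp 2 (volume : Measure ℝ)))) (U (ψ.toLp 2 (volume : Measure ℝ))) := by
    intro φ ψ
    rw [U.symm_apply_apply, U.inner_map_map]
    exact h' φ ψ
  -- the dense set of Schwartz representatives
  have hSdense : Dense (Set.range fun χ : SchwartzMap ℝ ℂ =>
      (χ.toLp 2 (volume : Measure ℝ) : Lp (α := ℝ) ℂ 2)) := by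
    have hd := SchwartzMap.denseRange_toLpCLM (F := ℂ) (E := ℝ) (μ := (volume : Measure ℝ)) (p := 2)
      ENNReal.ofNat_ne_top
    have hrange : Set.range (SchwartzMap.toLpCLM ℝ ℂ 2 (volume : Measure ℝ)) =
        Set.range fun χ : SchwartzMap ℝ ℂ => (χ.toLp 2 (volume : Measure ℝ) : Lp (α := ℝ) ℂ 2) := by
      ext x
      simp only [Set.mem_range, SchwartzMap.toLpCLM_apply]
    have hd' : Dense (Set.range (SchwartzMap.toLpCLM ℝ ℂ 2 (volume : Measure ℝ))) := hd
    rwa [hrange] at hd'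
  -- `𝓕` is onto `𝒮`, so every Schwartz representative is `U` of one
  have hrep : ∀ χ : SchwartzMap ℝ ℂ, ∃ φ : SchwartzMap ℝ ℂ,
      (χ.toLp 2 (volume : Measure ℝ) : Lp (α := ℝ) ℂ 2) = U (φ.toLp 2 (volume : Measure ℝ)) := fun χ =>
    ⟨𝓕⁻ χ, by rw [← hFL, fourier_fourierInv_eq]⟩
  -- Step 2: density
  refine ContinuousLinearMap.ext_on (hSdense.mono Submodule.subset_span) ?_
  rintro x ⟨χ, rfl⟩
  obtain ⟨φ, hφ⟩ := hrep χ
  dsimp only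
  rw [happly, hφ]
  refine Dense.eq_of_inner_right ℂ hSdense fun v hv => ?_
  obtain ⟨χ', rfl⟩ := hv
  obtain ⟨ψ, hψ⟩ := hrep χ'
  dsimp only
  rw [hψ, ← inner_conj_symm, key φ ψ, inner_conj_symm]

set_option maxHeartbeats 800000 in
/-- RH-FREE. Corollary: under the same Schwartz matrix-coefficient identity, `A` is an infinitesimal of infinite
order iff `B` is (unitary invariance of approximation numbers, `isInfiniteOrder_conj_iff`).
[cite: ConnesConsani2021, App. D Lemma 47 proof p. 33 (arXiv chunk p0033:L24–36); Connes1994, Chap. IV §2.α] -/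
theorem isInfiniteOrder_iff_of_inner_schwartz (A B : Lp (α := ℝ) ℂ 2 →L[ℂ] Lp (α := ℝ) ℂ 2)
    (h : ∀ φ ψ : SchwartzMap ℝ ℂ,
      inner ℂ (A (φ.toLp 2 (volume : Measure ℝ))) (ψ.toLp 2 (volume : Measure ℝ)) =
        inner ℂ (B ((𝓕 φ).toLp 2 (volume : Measure ℝ))) ((𝓕 ψ).toLp 2 (volume : Measure ℝ))) :
    IsInfiniteOrder A ↔ IsInfiniteOrder B := by
  rw [← fourierConj_eq_of_inner_schwartz A B h, isInfiniteOrder_conj_iff]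

end Literature.NumberTheory.ConnesConsani2021
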